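import Summits.BirchSwinnertonDyer.BirchSwinnertonDyer.Theorems.EisensteinPrimesCharResidualSelmerFinite
import Summits.BirchSwinnertonDyer.BirchSwinnertonDyer.Theorems.UniversalToricDescentResidualSelmerTransport
import HarnessLib

/-!
# Kummer for a character, BOTH halves, and the reflection of the Selmer conditions along
# `j_* : H¹(·, 𝔽(θ̄)) → H¹(·, (F/𝒪)(θ))` (Keller–Yin Lemma 1.2.4, local part)
# (cell `bsd-eis`, seat `bsd-line-x1-p1-w4` gen 3, D-0154 WIDTH PASS; crux 2 `GoodLatticeBDPValue`
# stmt-BirchSwinnertonDyer-19032, line `halves` v19, road (B) to `stub_imprimLambda` = KY Thm. 1.4.1 (iii))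

HONEST FRAMING (cell `bsd-eis`, run/shared/lean/pub/bsd-eis/): Galois-cohomology bookkeeping on constructed
objects; no definition, no named fact, no `sorry`, no `Theses` import; nothing about any curve is asserted; BSD /
IMC2 / KY Thm. 1.4.1 are proved for NO curve. Helper `--supports stmt-BirchSwinnertonDyer-19032` (file 1 of 2; the
Selmer-level bijection and the count `#R_nr^{S₀}(K_∞, 𝔽(θ̄)) = p^{λ(𝔛_θ^{S₀})} · #𝔛_θ^{S₀}[p]` are file 2,
`Theorems/EisensteinPrimesCharResidualSelmerCount.lean`).

## Why
After halves v19 the algebraic side of crux 2 rests on ONE preprint identity, KY Thm. 1.4.1 (iii)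
`λ(𝔛^{Sf}_f) + [𝟙̃|_{G_K} = 𝟙] = λ(𝔛^{Sf}_ω̃) + λ(𝔛^{Sf}_𝟙̃)` (`stub_imprimLambda`). Its printed proof
(arXiv:2402.12781v2 §1.4) is a residual-Selmer DIMENSION COUNT whose entry point for each character is
Lemma 1.2.4 `H¹_{𝓕_nr^S}(K, M_θ[π]) ≅ H¹_{𝓕_nr^S}(K, M_θ)[π]`. The LEAD's `CharResidualSelmerFinite` (p634599)
proved the INJECTIVITY of `j_*` on `H¹(H, ·)` for every `H ≤ Γ_K`; this file adds the SURJECTIVITY onto the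
`p`-torsion and the REFLECTION of each local condition, in the tree's `K_∞`-currency:

* §1 (generic topological group `G`, discrete `G`-modules, `j : A ↪ B` equivariant onto `B[p]`):
  `coboundary_lift_of_invariants_divisible` — if `B^G` is `p`-divisible inside `B^G` the LEAD's injectivity
  criterion applies (`resH1Hom_id_injective_of_invariants_divisible`); `exists_resH1Hom_id_eq_of_nsmul_eq_zero`
  — if `B` is `p`-divisible (orbit maps continuous), every `p`-torsion class of `H¹(G, B)` is `j_*` of a class
  of `H¹(G, A)` (explicit cocycles: `pφ = ∂b`, `b = pb₁`, `φ − ∂b₁` is `B[p]`-valued);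
  `continuous_smul_const_of_isOpen_stabilizer`.
* §2 `B = (F/𝒪)(θ)`, `θ^{p−1} = 1`: `p`-divisible (`ℚ_p/ℤ_p`); under ANY action through `Γ_K` the invariants
  are `B` or `0` (Teichmüller: `θ(g) − 1 ∈ ℤ_p^×` once `θ(g) ≠ 1`), hence `p`-divisible in themselves;
  orbit maps continuous (open stabilisers).
* §3 LOCAL REFLECTION along `j_*` (`H ≤ Γ_K`): the unramified condition at `v` (injectivity on `H ⊓ I_v`),
  Greenberg's inertia condition for Castella's strict datum `M⁺ = 0` (= the unramified condition,
  `mem_greenbergKer_strictDatum_iff`, any `H`, any `M`), the vacuous relaxed datum, and Castella's strict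
  condition at `v` (injectivity on `H ⊓ D_v`) hold for `c` iff they hold for `j_* c`.

References: [KellerYin2024] Lemma 1.2.4 (arXiv:2402.12781v2 TeX L760–778); [CastellaGrossiLeeSkinner2022]
Lemma 13 (arXiv:2008.02571 §1.2); [GreenbergVatsal2000] §2 pp. 16–17; [Greenberg1989] §1 p. 98;
[SerreGaloisCohomology1997] I.§2.2–2.4.
-/

set_option autoImplicit false
set_option linter.dupNamespace false -- the summit namespace `…BirchSwinnertonDyer.BirchSwinnertonDyer.Theorems` (Sub = Summit, D-0017) trips it

noncomputable section

open scoped Classical AddSubgroup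

universe u

namespace Summit.BirchSwinnertonDyer.BirchSwinnertonDyer.Theorems.CharResidualSelmerCount

open NumberField IsDedekindDomain Field
open Literature.NumberTheory.EllipticCurves Literature.NumberTheory.EllipticCurves.GreenbergSelmer
  Literature.NumberTheory.EllipticCurves.GreenbergVatsal2000 Literature.NumberTheory.GaloisRepresentations
  Literature.NumberTheory.EllipticCurves.KellerYin2024 Literature.NumberTheory.IwasawaTheory
  Literature.NumberTheory.EllipticCurves.FineSelmerCoefficientMap
  Summit.BirchSwinnertonDyer.BirchSwinnertonDyer.Theorems.CharResidualSelmerFinite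
  Summit.BirchSwinnertonDyer.BirchSwinnertonDyer.Theorems.UniversalToricDescentResidualSelmer

/-! ### §1 Generic: both halves of the Kummer sequence `H¹(G, A) → H¹(G, B)[p]` for `A = B[p]` -/

section Generic

variable {G : Type u} [Group G] [TopologicalSpace G] [IsTopologicalGroup G]
variable {A : Type u} [AddCommGroup A] [DistribMulAction G A] [TopologicalSpace A] [DiscreteTopology A]
variable {B : Type u} [AddCommGroup B] [DistribMulAction G B] [TopologicalSpace B] [DiscreteTopology B]
variable {p : ℕ}

omit [IsTopologicalGroup G] [TopologicalSpace A] [DiscreteTopology A] [TopologicalSpace B]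
  [DiscreteTopology B] in
/-- **Coboundary lift from divisible invariants.** `j : A ↪ B` equivariant onto `B[p]`; if every
`G`-invariant of `B` has a `G`-invariant `p`-th root (i.e. `B^G/p = 0`, the connecting map
`B^G → H¹(G, A)` vanishes), then every `b` whose coboundary is `j(A)`-valued has `∂b = j ∘ ∂a`:
`p·b ∈ B^G`, pick `b' ∈ B^G` with `pb' = pb`, then `b − b' = j a`.
[cite: SerreGaloisCohomology1997, I.§2.2 (Prop. 2, cohomology sequence)] -/
theorem coboundary_lift_of_invariants_divisible (j : A →+ B)
    (hj : ∀ (g : G) (a : A), j (ContinuousMonoidHom.id G g • a) = g • j a)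
    (hrange : ∀ x : B, x ∈ j.range ↔ p • x = 0)
    (hinv : ∀ b : B, (∀ g : G, g • b = b) → ∃ b' : B, (∀ g : G, g • b' = b') ∧ p • b' = b)
    (b : B) (hb : ∀ g : G, g • b - b ∈ j.range) :
    ∃ a : A, ∀ g : G, g • b - b = j (g • a - a) := by
  -- `p • b` is `G`-invariant
  have hpb : ∀ g : G, g • (p • b) = p • b := fun g ↦ by
    have h0 : p • (g • b - b) = 0 := (hrange _).mp (hb g)
    rwa [smul_sub, sub_eq_zero, smul_comm] at h0
  obtain ⟨b', hb'G, hpb'⟩ := hinv (p • b) hpb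
  -- `b - b'` is `p`-torsion, hence in the image of `j`
  obtain ⟨a, ha⟩ : b - b' ∈ j.range := (hrange _).mpr (by rw [smul_sub, hpb', sub_self])
  refine ⟨a, fun g ↦ ?_⟩
  have hj' : j (g • a) = g • j a := hj g a
  rw [map_sub, hj', ha, smul_sub, hb'G]
  abel

/-- **`j_* : H¹(G, A) → H¹(G, B)` is injective when `B^G` is `p`-divisible in itself** (`j : A ↪ B`
equivariant onto `B[p]`): the LEAD's criterion `resH1Hom_id_injective_of_coboundary_lift` fed by
`coboundary_lift_of_invariants_divisible`. [cite: SerreGaloisCohomology1997, I.§2.2 (Prop. 2)]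
[cite: KellerYin2024, Lemma 1.2.4 (arXiv:2402.12781v2 TeX L760–778)] -/
theorem resH1Hom_id_injective_of_invariants_divisible (j : A →+ B)
    (hj : ∀ (g : G) (a : A), j (ContinuousMonoidHom.id G g • a) = g • j a) (hinj : Function.Injective j)
    (hrange : ∀ x : B, x ∈ j.range ↔ p • x = 0)
    (hinv : ∀ b : B, (∀ g : G, g • b = b) → ∃ b' : B, (∀ g : G, g • b' = b') ∧ p • b' = b) :
    Function.Injective (resH1Hom (ContinuousMonoidHom.id G) j hj) :=
  resH1Hom_id_injective_of_coboundary_lift j hj hinj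
    (coboundary_lift_of_invariants_divisible j hj hrange hinv)

/-- **Every `p`-torsion class of `H¹(G, B)` comes from `H¹(G, A)`** when `B` is `p`-divisible (and the
orbit maps `g ↦ g • b` are continuous, so that principal crossed homomorphisms are continuous):
`p[φ] = 0` means `pφ = ∂b`; with `b = pb₁`, `φ − ∂b₁` is killed by `p`, hence `j(A)`-valued, hence `j ∘ α`
for a continuous crossed homomorphism `α` of `A`, and `j_*[α] = [φ − ∂b₁] = [φ]`.
[cite: SerreGaloisCohomology1997, I.§2.2 (Prop. 2, exactness at `H¹(G, B)`)]
[cite: KellerYin2024, Lemma 1.2.4 (arXiv:2402.12781v2 TeX L760–778)] -/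
theorem exists_resH1Hom_id_eq_of_nsmul_eq_zero (j : A →+ B)
    (hj : ∀ (g : G) (a : A), j (ContinuousMonoidHom.id G g • a) = g • j a) (hinj : Function.Injective j)
    (hrange : ∀ x : B, x ∈ j.range ↔ p • x = 0)
    (hcont : ∀ b : B, Continuous fun g : G ↦ g • b) (hdiv : ∀ b : B, ∃ b' : B, p • b' = b)
    (y : discreteH1 G B) (hy : p • y = 0) :
    ∃ x : discreteH1 G A, resH1Hom (ContinuousMonoidHom.id G) j hj x = y := by
  obtain ⟨φ, rfl⟩ := oneCocycleClass_surjective _ y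
  -- `p • [φ] = [p • φ] = 0`, so `p • φ = ∂b`
  have hpφ : oneCocycleClass (discreteTopRep G B) ((p : ℤ) • φ) = 0 := by
    rw [oneCocycleClass_smul, Nat.cast_smul_eq_nsmul, hy]
  rw [oneCocycleClass_eq_zero_iff] at hpφ
  obtain ⟨b, hb⟩ := hpφ
  have hb' : ∀ g : G, p • φ.1 g = g • b - b := fun g ↦ by
    have h := hb g
    change (p : ℤ) • φ.1 g = g • b - b at h
    rwa [natCast_zsmul] at h
  -- `b = p • b₁`; the principal crossed homomorphism of `b₁`
  obtain ⟨b₁, hb₁⟩ := hdiv b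
  let π : contOneCocycles (discreteTopRep G B) :=
    ⟨⟨fun g ↦ g • b₁ - b₁, (hcont b₁).sub continuous_const⟩, fun g h ↦ by
      change (g * h) • b₁ - b₁ = (g • b₁ - b₁) + g • (h • b₁ - b₁)
      rw [mul_smul, smul_sub]
      abel⟩
  -- `φ - π` is killed by `p`, hence `j(A)`-valued
  have hψ : ∀ g : G, p • (φ - π).1 g = 0 := fun g ↦ by
    change p • (φ.1 g - (g • b₁ - b₁)) = 0
    rw [smul_sub, hb', smul_sub, smul_comm p g b₁, hb₁, sub_self]
  have hex : ∀ g : G, ∃ a : A, j a = (φ - π).1 g := fun g ↦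
    AddMonoidHom.mem_range.mp ((hrange _).mpr (hψ g))
  choose s hs using hex
  refine ⟨oneCocycleClass _ (contOneCocycles.lift j hj hinj (φ - π) s hs), ?_⟩
  rw [resH1Hom_id_oneCocycleClass, contOneCocycles.push_lift, oneCocycleClass_sub, sub_eq_self]
  exact (oneCocycleClass_eq_zero_iff _ π).mpr ⟨b₁, fun g ↦ rfl⟩

omit [IsTopologicalGroup G] in
/-- **Orbit maps into a discrete module with OPEN stabilisers are continuous**: the fibre of
`g ↦ g • x` through `g` contains the open coset `g · Stab(x)`. [folklore] -/
theorem continuous_smul_const_of_isOpen_stabilizer [ContinuousMul G] {X : Type*} [MulAction G X]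
    [TopologicalSpace X] [DiscreteTopology X] (x : X)
    (h : IsOpen (MulAction.stabilizer G x : Set G)) : Continuous fun g : G ↦ g • x := by
  refine continuous_def.2 fun U _ ↦ isOpen_iff_mem_nhds.2 fun g hg ↦ ?_
  have hsub : (fun k : G ↦ g * k) '' (MulAction.stabilizer G x : Set G) ⊆ (fun g : G ↦ g • x) ⁻¹' U := by
    rintro _ ⟨k, hk, rfl⟩
    have hk' : k • x = x := MulAction.mem_stabilizer_iff.mp hk
    simp only [Set.mem_preimage, mul_smul, hk']
    exact hg
  exact Filter.mem_of_superset
    (((Homeomorph.mulLeft g).isOpenMap _ h).mem_nhds ⟨1, (MulAction.stabilizer G x).one_mem, mul_one g⟩)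
    hsub

end Generic

/-! ### §2 The character module `B = (F/𝒪)(θ)`: divisible, invariants divisible, continuous orbits -/

section Character

variable {K : Type} [Field K] {p : ℕ} [hp : Fact p.Prime]
  (θ : FramedGaloisRep K (padicCoeffIntegers (∅ : Set (PadicAlgCl p))) 1)

/-- **`(F/𝒪)(θ) ≅ ℚ_p/ℤ_p` is `p`-divisible**: `u·t_n = p·(u·t_{n+1})`.
[cite: KellerYin2024, §1.1 and Lemma 1.2.4 proof ("`M_θ` is `π`-divisible", arXiv:2402.12781v2 TeX L762)] -/
theorem charModule_divisible (b : charModule (∅ : Set (PadicAlgCl p)) θ) :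
    ∃ b' : charModule (∅ : Set (PadicAlgCl p)) θ, p • b' = b := by
  obtain ⟨z, rfl⟩ := (charModuleEquiv θ).symm.surjective b
  obtain ⟨n, u, rfl⟩ := QpModZp.exists_eq_smul_tgen z
  refine ⟨(charModuleEquiv θ).symm (u • QpModZp.tgen p (n + 1)), ?_⟩
  rw [← map_nsmul, smul_comm, ← Nat.cast_smul_eq_nsmul ℤ_[p], QpModZp.p_smul_tgen_succ]

/-- **Under any action through `Γ_K`, the invariants of `(F/𝒪)(θ)` are `p`-divisible in themselves**
(`θ^{p−1} = 1`; `G` acts by `g • b = φ(g) • b`): if `θ ∘ φ ≡ 1` every element is invariant and one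
divides inside `B`; otherwise some `θ(φ g₀) − 1` is a unit of `ℤ_p` (Teichmüller), so the invariants are
`0`. (KY Lemma 1.2.4: "`H⁰(K^Σ_∞/K_∞, F/𝒪(θ))` … both `π`-divisible: if `θ = 1`, they are `F/𝒪`; …
otherwise … `0`"; CGLS Lemma 13.) [cite: KellerYin2024, Lemma 1.2.4 (arXiv:2402.12781v2 TeX L766–772)]
[cite: CastellaGrossiLeeSkinner2022, Lemma 13 (arXiv:2008.02571 §1.2)] -/
theorem charModule_invariants_divisible (hθ : ∀ σ : absoluteGaloisGroup K, θ σ ^ (p - 1) = 1)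
    {G : Type*} [Monoid G] [DistribMulAction G (charModule (∅ : Set (PadicAlgCl p)) θ)]
    (φ : G → absoluteGaloisGroup K)
    (hφ : ∀ (g : G) (b : charModule (∅ : Set (PadicAlgCl p)) θ), g • b = φ g • b)
    (b : charModule (∅ : Set (PadicAlgCl p)) θ) (hb : ∀ g : G, g • b = b) :
    ∃ b' : charModule (∅ : Set (PadicAlgCl p)) θ, (∀ g : G, g • b' = b') ∧ p • b' = b := by
  by_cases htriv : ∀ g : G, unitChar θ (φ g) = 1
  · obtain ⟨b', hb'⟩ := charModule_divisible θ b
    refine ⟨b', fun g ↦ ?_, hb'⟩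
    obtain ⟨z, rfl⟩ := (charModuleEquiv θ).symm.surjective b'
    rw [hφ, galois_smul_charModuleEquiv_symm, htriv g, Units.val_one, one_smul]
  · obtain ⟨g₀, hg₀⟩ := not_forall.mp htriv
    have hb0 : b = 0 := by
      obtain ⟨z, rfl⟩ := (charModuleEquiv θ).symm.surjective b
      have h := hb g₀
      rw [hφ, galois_smul_charModuleEquiv_symm] at h
      have h' := (charModuleEquiv θ).symm.injective h
      have hupow : ((unitChar θ (φ g₀) : ℤ_[p]ˣ) : ℤ_[p]) ^ (p - 1) = 1 := by
        rw [← Units.val_pow_eq_pow_val, unitChar_pow_eq_one θ hθ, Units.val_one]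
      have hu1 : ((unitChar θ (φ g₀) : ℤ_[p]ˣ) : ℤ_[p]) ≠ 1 := fun h1 ↦ hg₀ (Units.ext h1)
      have hunit := isUnit_sub_one_of_pow_sub_one_eq_one_of_ne_one hupow hu1
      have hz0 : z = 0 := by
        have e : (((unitChar θ (φ g₀) : ℤ_[p]ˣ) : ℤ_[p]) - 1) • z = 0 := by
          rw [sub_smul, one_smul, h', sub_self]
        exact hunit.smul_eq_zero.mp e
      rw [hz0, map_zero]
    exact ⟨0, fun g ↦ smul_zero g, by rw [hb0, smul_zero]⟩

/-- **Orbit maps of `Γ_K` on `(F/𝒪)(θ)` are continuous** (stabilisers are open, tree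
`isOpen_stabilizer_cofree`). [cite: Greenberg1989, §1 p. 98 (discrete `G`-modules)] -/
theorem continuous_smul_charModule (b : charModule (∅ : Set (PadicAlgCl p)) θ) :
    Continuous fun σ : absoluteGaloisGroup K ↦ σ • b :=
  continuous_smul_const_of_isOpen_stabilizer b (isOpen_stabilizer_cofree (∅ : Set (PadicAlgCl p)) θ b)

end Character

/-! ### §3 Local reflection of the Selmer conditions along `j_*` -/

section Local

variable {K : Type} [Field K] [NumberField K] {p : ℕ} [hp : Fact p.Prime]
  (θ : FramedGaloisRep K (padicCoeffIntegers (∅ : Set (PadicAlgCl p))) 1)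
  (H : Subgroup (absoluteGaloisGroup K))

/-- **Greenberg's inertia condition for Castella's strict datum `M⁺_v = 0` IS the unramified condition**
(any `H ≤ Γ_K`, any discrete `M`): `M ⧸ M⁺_v = M ⧸ 0`, and `grMk : M → M ⧸ 0` is a bijection, so a
class dies in `H¹(H ⊓ I_v, M ⧸ 0)` iff it dies in `H¹(H ⊓ I_v, M)` (on explicit cocycles). The tree's
`GreenbergFullAtSelmer.greenbergKer_strictDatum_le_unramifiedKer` is one direction for `H = pairKer`.
[cite: Greenberg1989, §1 p. 98 (4)] [cite: Castella2018, Def. 2.2 (arXiv:1704.06608 p. 5)] -/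
theorem mem_greenbergKer_strictDatum_iff {M : Type} [AddCommGroup M]
    [DistribMulAction (absoluteGaloisGroup K) M] [TopologicalSpace M] [DiscreteTopology M]
    (v : HeightOneSpectrum (𝓞 K)) (c : subgroupH1 H M) :
    c ∈ (Castella2018.AcSelmer.strictDatum M v).greenbergKer H ↔ c ∈ unramifiedKer H M v := by
  obtain ⟨f, rfl⟩ := oneCocycleClass_surjective _ c
  have hinjN : Function.Injective (Castella2018.AcSelmer.strictDatum M v).grMk := by
    rw [injective_iff_map_eq_zero]
    intro a ha
    have ha' : a ∈ (Castella2018.AcSelmer.strictDatum M v).grMk.ker := ha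
    rw [LocalDatum.ker_grMk] at ha'
    exact (AddSubgroup.mem_bot).mp ha'
  rw [LocalDatum.mem_greenbergKer_iff, LocalDatum.greenbergMap, resH1Hom_oneCocycleClass,
    oneCocycleClass_eq_zero_iff, GreenbergVatsal2000.unramifiedKer, AddMonoidHom.mem_ker,
    resH1Hom_oneCocycleClass, oneCocycleClass_eq_zero_iff]
  constructor
  · rintro ⟨mbar, hm⟩
    obtain ⟨m, rfl⟩ := (Castella2018.AcSelmer.strictDatum M v).grMk_surjective mbar
    refine ⟨m, fun x ↦ hinjN ?_⟩
    have key := hm x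
    rw [contOneCocycles.pullback_apply] at key ⊢
    change (Castella2018.AcSelmer.strictDatum M v).grMk (f.1 (inertiaInToH H v x)) = _ at key
    change (Castella2018.AcSelmer.strictDatum M v).grMk
        ((AddMonoidHom.id M) (f.1 (inertiaInToH H v x))) = _
    rw [AddMonoidHom.id_apply, key, map_sub]
    rfl
  · rintro ⟨m, hm⟩
    refine ⟨(Castella2018.AcSelmer.strictDatum M v).grMk m, fun x ↦ ?_⟩
    have key := hm x
    rw [contOneCocycles.pullback_apply] at key ⊢
    change (AddMonoidHom.id M) (f.1 (inertiaInToH H v x)) = _ at key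
    change (Castella2018.AcSelmer.strictDatum M v).grMk (f.1 (inertiaInToH H v x)) = _
    rw [AddMonoidHom.id_apply] at key
    rw [key, map_sub]
    rfl

/-- Greenberg's condition for Castella's RELAXED datum `M⁺_v = M` is vacuous (`M ⧸ M⁺_v = 0`).
[cite: Castella2018, §2.1 (arXiv:1704.06608 p. 5), "`H¹(K_𝔭̄, V)` if `w = 𝔭̄`"] -/
theorem greenbergKer_relaxedDatum_eq_top {M : Type} [AddCommGroup M]
    [DistribMulAction (absoluteGaloisGroup K) M] [TopologicalSpace M] [DiscreteTopology M]
    (v : HeightOneSpectrum (𝓞 K)) :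
    (Castella2018.AcSelmer.relaxedDatum M v).greenbergKer H = ⊤ :=
  top_le_iff.mp fun c _ ↦ (Castella2018.AcSelmer.relaxedDatum M v).strictKer_le_greenbergKer H
    (by rw [Castella2018.AcSelmer.strictKer_relaxedDatum_eq_top]; trivial)

/-- Castella's STRICT condition at `v` is "the restriction to `H ⊓ D_v` vanishes" (Castella's strict
datum is the tree's fine datum; `mem_strictKer_fineLocalDatum_iff`). [cite: Greenberg1989, §1 p. 98 (the strict condition)] -/
theorem mem_strictKer_strictDatum_iff_resOfLe {M : Type} [AddCommGroup M]
    [DistribMulAction (absoluteGaloisGroup K) M] [TopologicalSpace M] [DiscreteTopology M]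
    (v : HeightOneSpectrum (𝓞 K)) (c : subgroupH1 H M) :
    c ∈ (Castella2018.AcSelmer.strictDatum M v).strictKer H ↔
      resOfLe M (inf_le_left : H ⊓ decomp v ≤ H) c = 0 :=
  mem_strictKer_fineLocalDatum_iff H v c

variable {A : Type} [AddCommGroup A] [DistribMulAction (absoluteGaloisGroup K) A] [TopologicalSpace A]
  [DiscreteTopology A]

/-- **`j_*` is injective on `H¹(H ⊓ I_v, ·)`** (the inertia group of `L = K̄^H` at the place above `v`,
a subgroup of `D_v` acting through `Γ_K`): §1's criterion with §2's divisible invariants.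
[cite: KellerYin2024, Lemma 1.2.4 (arXiv:2402.12781v2 TeX L760–778)] [cite: CastellaGrossiLeeSkinner2022, Lemma 13] -/
theorem resH1Hom_id_injective_charModule_inertiaIn
    (hθ : ∀ σ : absoluteGaloisGroup K, θ σ ^ (p - 1) = 1) (v : HeightOneSpectrum (𝓞 K))
    (j : A →+ charModule (∅ : Set (PadicAlgCl p)) θ)
    (hj : ∀ (σ : absoluteGaloisGroup K) (a : A), j (σ • a) = σ • j a) (hinj : Function.Injective j)
    (hrange : ∀ x : charModule (∅ : Set (PadicAlgCl p)) θ, x ∈ j.range ↔ p • x = 0) :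
    Function.Injective (resH1Hom (ContinuousMonoidHom.id (inertiaIn H v)) j
      (fun x a ↦ hj ((x : decomp (K := K) v) : absoluteGaloisGroup K) a)) :=
  resH1Hom_id_injective_of_invariants_divisible (G := inertiaIn H v) j _ hinj hrange
    (charModule_invariants_divisible θ hθ (G := inertiaIn H v)
      (fun x ↦ ((x : decomp (K := K) v) : absoluteGaloisGroup K)) (fun _ _ ↦ rfl))

/-- **The unramified condition at `v` reflects along `j_*`**: `c ∈ H¹(H, A)` dies on `H ⊓ I_v` iff
`j_* c` does (`j_*` commutes with restriction, `res_inertiaIn_comp_resH1Hom_id`, and is injective on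
`H¹(H ⊓ I_v, ·)`). [cite: KellerYin2024, Lemma 1.2.4 (arXiv:2402.12781v2 TeX L760–778)]
[cite: GreenbergVatsal2000, §2 p. 17] -/
theorem mem_unramifiedKer_iff_resH1Hom_id_mem
    (hθ : ∀ σ : absoluteGaloisGroup K, θ σ ^ (p - 1) = 1) (v : HeightOneSpectrum (𝓞 K))
    (j : A →+ charModule (∅ : Set (PadicAlgCl p)) θ)
    (hj : ∀ (σ : absoluteGaloisGroup K) (a : A), j (σ • a) = σ • j a) (hinj : Function.Injective j)
    (hrange : ∀ x : charModule (∅ : Set (PadicAlgCl p)) θ, x ∈ j.range ↔ p • x = 0)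
    (c : subgroupH1 H A) :
    c ∈ unramifiedKer H A v ↔
      resH1Hom (ContinuousMonoidHom.id H) j (fun g a ↦ hj (g : absoluteGaloisGroup K) a) c ∈
        unramifiedKer H (charModule (∅ : Set (PadicAlgCl p)) θ) v := by
  refine ⟨fun hc ↦ resH1Hom_id_mem_unramifiedKer H v j hj _ hc, fun hc ↦ ?_⟩
  rw [GreenbergVatsal2000.unramifiedKer, AddMonoidHom.mem_ker] at hc ⊢
  have e := congrArg (fun f ↦ f c) (res_inertiaIn_comp_resH1Hom_id H v j
    (fun g a ↦ hj (g : absoluteGaloisGroup K) a) (fun x a ↦ hj _ a))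
  simp only [AddMonoidHom.comp_apply] at e
  rw [e] at hc
  exact (injective_iff_map_eq_zero _).mp
    (resH1Hom_id_injective_charModule_inertiaIn θ H hθ v j hj hinj hrange) _ hc

/-- **Castella's strict condition at `v` reflects along `j_*`**: `c` dies on `H ⊓ D_v` iff `j_* c` does
(`resOfLe_comp_resH1Hom_id` + the LEAD's injectivity of `j_*` on `H¹(H ⊓ D_v, ·)`).
[cite: KellerYin2024, Lemma 1.2.4 (arXiv:2402.12781v2 TeX L760–778)] [cite: Greenberg1989, §1 p. 98] -/
theorem mem_strictKer_strictDatum_iff_resH1Hom_id_mem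
    (hθ : ∀ σ : absoluteGaloisGroup K, θ σ ^ (p - 1) = 1) (v : HeightOneSpectrum (𝓞 K))
    (j : A →+ charModule (∅ : Set (PadicAlgCl p)) θ)
    (hj : ∀ (σ : absoluteGaloisGroup K) (a : A), j (σ • a) = σ • j a) (hinj : Function.Injective j)
    (hrange : ∀ x : charModule (∅ : Set (PadicAlgCl p)) θ, x ∈ j.range ↔ p • x = 0)
    (c : subgroupH1 H A) :
    c ∈ (Castella2018.AcSelmer.strictDatum A v).strictKer H ↔
      resH1Hom (ContinuousMonoidHom.id H) j (fun g a ↦ hj (g : absoluteGaloisGroup K) a) c ∈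
        (Castella2018.AcSelmer.strictDatum (charModule (∅ : Set (PadicAlgCl p)) θ) v).strictKer H := by
  rw [mem_strictKer_strictDatum_iff_resOfLe, mem_strictKer_strictDatum_iff_resOfLe]
  have e := congrArg (fun f ↦ f c) (resOfLe_comp_resH1Hom_id (inf_le_left : H ⊓ decomp v ≤ H) j
    (fun g a ↦ hj (g : absoluteGaloisGroup K) a) (fun g a ↦ hj (g : absoluteGaloisGroup K) a))
  simp only [AddMonoidHom.comp_apply] at e
  rw [e]
  refine ⟨fun hc ↦ by rw [hc, map_zero], fun hc ↦ ?_⟩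
  exact (injective_iff_map_eq_zero _).mp
    (resH1Hom_id_injective_charModule θ hθ (H ⊓ decomp v) j hj hinj hrange) _ hc

end Local

end Summit.BirchSwinnertonDyer.BirchSwinnertonDyer.Theorems.CharResidualSelmerCount

end
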